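import Summits.RiemannHypothesis.RiemannHypothesis.Theorems.GroundBartaEvenWinsBeyondArchPhantomXT80M4Data4
import HarnessLib

/-!
# RiemannHypothesis / GroundBarta machinery — phantom chain XT80M4: kernel check of data chunk 4

Helper DATA file (`--supports stmt-RiemannHypothesis-18085 --as helper`), RH-free.  Seat rh-explicit-weil-6 (CALIBRATION certificate M80X = STEP-0 row B-W-format-A′, memo run/shared/lean/pub/rh-explicit/WEIL6-APRIME.md §1.1).  Part of the T = 80 lattice-ripple (phantom) chain `xt80m4Cells` for the MINIMAL separable 4-harmonic phantom `rsOfSep xt80m4Ph2 xt80m4Ph3` (θ₂-harmonics j = 3, 4; θ₃-harmonics k = 2, 3; coefficients = weil-6 LP optimum rounded to 2⁻¹⁶, certified one-prime dips 0.78676 / 0.78470 in `…PhantomLevelCosPoly.lean`): Taylor-sum cells `XTCell` (format of seat weil-1, `…LatticeRippleTaylorCells.lean`) of width 1/2, order n = 24, two-sided engine claims with margin 2e-8, generated by weil-1's `gen/phantomgen.py` (exact mirror of the checker; nothing about the data is trusted — only kernel-evaluated Booleans are consumed).  With the boosted tail level wL = 2116/1000 (`level_M80X`: ∀ |t| ≥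 80, 2.116 ≤ w₂₃(t) + P(t)) this chain turns the LANDED two-prime T80 chain (`weilTwoPrimeCellsT80`, amplitude level 1.440047) into a level-2.116 chain for the phantom certificate format `WeilCert23X`.
-/

set_option linter.dupNamespace false

noncomputable section

namespace Summit.RiemannHypothesis.RiemannHypothesis.Theorems.EvenWinsBeyondArch

open Literature.NumberTheory.LFunctions

/-- Every cell of chunk 4 passes the integer checker `XTCell.checkZ` (kernel evaluation). [folklore] -/
theorem checkZ_xt80m4Cells4 : (xt80m4Cells4.all XTCell.checkZ) = true := by
  decide +kernel

end Summit.RiemannHypothesis.RiemannHypothesis.Theorems.EvenWinsBeyondArch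

end
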